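import Literature.MathematicalPhysics.QuantumFieldTheory.Balaban1983to89.Node00.N24NodesStage12Pointed
import Literature.MathematicalPhysics.QuantumFieldTheory.Balaban1983to89.B12NodeKnitRecord12

/-!
# NODE N24 · (B2) AND CRUX K1′'s STUB BODIES AT NODE 00's STAGE-12 RECORD WITH N09 ENTERED BY NAME — `B12NodeKnitRecord12` (the ₁₂ twin of seat dag-n09-d's Stage-11 junction:
# the Theorem-3 member from [B11] Thm 1 at the record's objects and the record's own proviso) replaces the last pure binder `h09` of modules 23 ∕ 24 ∕ 26 and the displayed
# Theorem-3 member `h09T` of module 27: NO PURE NODE BINDER IS LEFT in N24's Stage-12 knit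

TRACK A (YM-PLAN §2d, node N24 of 28 = binder B2 `hB : B16.EndStatementBPrinted D.C`), seat `pub-ymgap-dag-n24-c` (R134 fan-out seat, strategy s2; gen 2; g0 HANDOFF trigger (t1)
«n09's Literature ₁₂ junction ⇒ `…₁₂C_knit_N09_N11_pinned`»).  TWENTY-EIGHTH N24 module, a NEW importing one (modules 1–27 untouched; imports module 27 `N24NodesStage12Pointed` and
`B12NodeKnitRecord12`).  THEOREMS ONLY, def-free, sorry-free, standard axioms.  = module 22 `N24KnitStage11C`'s N09 step re-keyed ₁₁ ↦ ₁₂ by name, in all three currencies of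
record at ₁₂: (B2) over a given record (module 24), the thirteen-node conjunction over a given record (module 26), and the closer's pointed form (module 27).

N09 BY NAME.  [Balaban1987RG1]'s node `Dag.B12_main` = «in-edges → own leaf `b12` ∧ (b12 → b13 → (interval ⇒ small-field inductive assumptions))»; at a world bound to the
Stage-12 construction its Theorem-3 member `smallCouplings → smallFieldInductive` follows from [Balaban1985Variational] Thm 1 at the record's level domains `domAltOfRecord F N θ.ν`
((1.1) existence + uniqueness `h11dom`, `HRestrict` `hres`, uniqueness at the averaged minimisers `huniq` — N07's content at the record) and the record's own proviso `contT`
(`B12NodeKnitRecord12.thm3Member_stage12_of_hRestrict` ∕ `b12_main_at_record₁₂C_of_leaf`); conjunct 1 is the own leaf `Lemma4Printed (θ.res.X P).F12 (θ.res.X P).c12` over the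
presentation's residual B12 carriers (`slot12`; its pin: node00-def's `Record12CarriersB12` ∕ def-B12's package records).  So `h09 : ∀ P, Dag.B12_main (leavesP w P)` becomes FOUR
KEYED BINDERS at the record's objects (`slot12`, `h11dom`, `hres`, `huniq`), exactly as at ₁₀ ∕ ₁₁ (modules 19 ∕ 22).

WHAT THIS FILE PROVES.
§0 `N24_b12_main_of_isRecordOfRecord₁₂C_of_slots` — N09 at every run of a ₁₂C record from the four keyed binders (n09's `b12_main_at_record₁₂C_of_leaf`, by name).
§1 **`N24_at_record₁₂C_knit_N09_N11_pinned`** — (B2) at a ₁₂C record: module 24's `N24_at_record₁₂C_knit_N11_pinned` with `h09` ↦ the four keyed binders (= HANDOFF (t1)'s deliverable);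
   `N24_stabilityBR12e_thetaShape15_knit_N09_N11_pinned` — K1′'s rev-15 consequent shape, same substitution (module 26 §3).
§2 **`N24_nodes₁₂C_knit_N09_N11_pinned`** — the thirteen-node conjunction at the re-read world (module 26 §1 with `h09` ↦ the four keyed binders): WHICH CHILD BLOCKS `stub_nodes12` AT A
   ₁₂C RECORD WITH NO PURE BINDER: six residual-carrier sockets, N09 ×4 keyed, N11 ×1 (S1ᵀ), N13 `hR` + `hcor3`.
§3 the closer's pointed form with N09 by name: **`N24_nodes₁₂_pointed_N09`** (module 27 §1 with `h09T` ↦ [B11] Thm 1 at θ's level domains, pointwise in the run),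
   `N24_betaWindowAtSomeRecord₁₂_of_pointed_N09_of_boxH`, **`N24_stabilityBR12e_thetaShape15_pointed_N09`** (K1′'s rev-15 consequent from the pointed children + β-box pair).

WHICH CHILD BLOCKS AT ₁₂ AFTER THIS FILE (kernel form): THEOREMS — N01 N02 N03 N04, guarded (0.20), (S0) base, window ∕ interval packaging; N09's and N11's JUNCTIONS consumed by name
(their displayed inputs: N09 ← own leaf + [B11] Thm 1 ×3 at the level domains; N11 ← (S1ᵀ)); N13 world-level (𝐑-leaf + Cor.-3 ×5; seat dag-n13's `B16…Record12` junction = HANDOFF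
(t2), not in tree); six residual-carrier leaves (N05 N06 N07 N08 N10 N12); β-box pair (β⁺ [I] p. 264; `b > 0` NODE O); inhabitation + guard = K0′ `Record12Inhabited` (19902).
HONEST FRAMING: kernel bookkeeping BY NAME; nothing of Bałaban's asserted; every slot DISPLAYED; N24 COMPOSITE — no discharge, no count, no stub closed; one finite T⁴ programme at
fixed ε; NOT continuum ∕ ℝ⁴ ∕ OS ∕ mass gap ∕ Clay.
-/

noncomputable section

open scoped Matrix.Norms.L2Operator

namespace Literature.MathematicalPhysics.QuantumFieldTheory.Balaban1983to89.Node00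

open DagBinding T4Continuum T4DatumAssembly FlowStepRuns AveragingRT
open FlowStep (BetaLowerH BetaUpperH)

variable {F : T4Family} {N : ℕ} [NeZero N] {D : FiniteEpsData F (SU N)} {w : WorldP}

/-! ## §0. N09 at every run of a Stage-12 record from the four keyed binders (n09's junction, by name) -/

/-- **N09 · [Balaban1987RG1] AT EVERY RUN OF A STAGE-12 RECORD, BY NAME** — `B12NodeKnitRecord12.b12_main_at_record₁₂C_of_leaf`: the own leaf `Lemma4Printed (θ.res.X P).F12
(θ.res.X P).c12` over the presenting parameters binding the world (`slot12`, [Balaban1987RG1] Lemma 4 (3.53) over the residual B12 carriers) and [Balaban1985Variational] Thm 1 at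
the record's level domains — (1.1) existence + uniqueness (`h11dom`), `HRestrict` (`hres`), uniqueness at the averaged minimisers (`huniq`); the record's own `contT` inside.
[cite: Balaban1987RG1, Thm 1 p.259, Thm 3 p.264, Lemma 4 (3.53) p.280, (1.1)–(1.3) p.260; Balaban1985Variational, Thm 1 (8)–(10) p.279 (node bookkeeping at the Stage-12 record)] -/
theorem N24_b12_main_of_isRecordOfRecord₁₂C_of_slots (h : IsRecordOfRecord₁₂C F N D w)
    (slot12 : ∀ (θ : Stage12Params F N) (hP : θ.Provisos₁₂ F N), θ.Admissible F N → D = datumOfRecord₁₂ F N θ hP → w.γ ≤ θ.γ →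
      (∀ P, w.up P = upOfRecord₅C F N (θ.toStage5₁₂ F N) P) → ∀ P : B12.RunParams, B12Sec2to5.Lemma4Printed (θ.res.X P).F12 (θ.res.X P).c12)
    (h11dom : ∀ (θ : Stage12Params F N) (hP : θ.Provisos₁₂ F N), θ.Admissible F N → D = datumOfRecord₁₂ F N θ hP → w.γ ≤ θ.γ →
      ∀ (p : B12.RunParams) (k : ℕ), k ≤ p.K →
        ∀ V ∈ domAltOfRecord F N θ.ν p.K k, UkExists F N p.K k θ.εbg V ∧ UniqueUkOrbit F N p.K k θ.εbg V)
    (hres : ∀ (θ : Stage12Params F N) (hP : θ.Provisos₁₂ F N), θ.Admissible F N → D = datumOfRecord₁₂ F N θ hP → w.γ ≤ θ.γ →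
      ∀ (p : B12.RunParams) (k : ℕ), k ≤ p.K → HRestrict F N θ.εbg p.K k (domAltOfRecord F N θ.ν p.K k))
    (huniq : ∀ (θ : Stage12Params F N) (hP : θ.Provisos₁₂ F N), θ.Admissible F N → D = datumOfRecord₁₂ F N θ hP → w.γ ≤ θ.γ →
      ∀ (p : B12.RunParams) (k : ℕ), k ≤ p.K → ∀ V ∈ domAltOfRecord F N θ.ν p.K k, ∀ j < k,
        UniqueUkOrbit F N p.K (j + 1) θ.εbg (Averaging.iter (avOfRecord F N p.K) (j + 1) (Uk F N p.K k θ.εbg V)))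
    (P : B12.RunParams) : Dag.B12_main (leavesP w P) :=
  B12NodeKnitRecord12.b12_main_at_record₁₂C_of_leaf h slot12 h11dom hres huniq P

/-! ## §1. (B2) and K1′'s consequent shape at a Stage-12 record, N09 and N11 by name -/

/-- **N24 · (B2) AT THE STAGE-12 RECORD, N09 AND N11 ENTERED AT THE RECORD'S OWN PARAMETERS BY NAME** (module 24's `N24_at_record₁₂C_knit_N11_pinned` with the binder `h09`
replaced by §0): six θ-keyed residual-carrier sockets (X-[B8] N05 ∕ X-[B10] N08 ∕ X-B13 N10 ∕ Y N06 ∕ Z N07 ∕ W N12), **N09** ← own leaf `slot12` + [B11] Thm 1 ×3 (`h11dom`, `hres`,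
`huniq`), **N11** ← (S1ᵀ) `slot11`, **N13** world-level (`hR` + `hcor3`), β-box on `D.βfun` over `]0, γ₀]`.  THE HYPOTHESIS LIST IS «WHICH CHILD BLOCKS AT ₁₂C» WITH NO PURE NODE BINDER.
[cite: Balaban1989LargeFieldII, Thm 1 p.355, (0.1) pp.355–356, p.387, p.391; Balaban1988Convergent, Thm 1 p.262, Theorem p.245, p.244, Cor. 3 (2.50) p.264; Balaban1987RG1, Thm 1 p.259, Thm 3 p.264, Lemma 4 (3.53) p.280, (1.1)–(1.3) p.260, (1.22) p.264; Balaban1985Variational, Thm 1 (8)–(10) p.279; Balaban1985RegularSpaces, Thms 2, 4, 8 pp.83–101; Balaban1985BackgroundPropagators, Thms 3.1–3.15 pp.397–432; Balaban1985UV3, Thm 1 p.257 + Thm 2 p.272; Balaban1988RG2Cluster, Lemmas 1–3 pp.9, 11, 20; Balaban1989LargeFieldI, Prop. 1 p.194; Balaban1984PropagatorsII, pp.234–249 (bookkeeping over the Stage-12 record)] -/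
theorem N24_at_record₁₂C_knit_N09_N11_pinned (h : IsRecordOfRecord₁₂C F N D w) {γ₀ : ℝ} (hγ₀ : w.γ ≤ γ₀)
    (slots₀₅ : ∀ (θ : Stage12Params F N) (hP : θ.Provisos₁₂ F N), θ.Admissible F N → D = datumOfRecord₁₂ F N θ hP →
      (∀ P, w.up P = upOfRecord₅C F N (θ.toStage5₁₂ F N) P) → ∀ P : B12.RunParams,
        B8LeafR (θ.res.X P).d8 (θ.res.X P).L8 (θ.res.X P).C₂ (θ.res.X P).B₁' (θ.res.X P).B₀' (θ.res.X P).B₁ (θ.res.X P).B₂ (θ.res.X P).c₁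
          (θ.res.X P).inp8 (θ.res.X P).B₀β (θ.res.X P).loc8 (θ.res.X P).fam8R (θ.res.X P).lan8 (θ.res.X P).cub8 (θ.res.X P).toAxial8)
    (slots₀₆ : ∀ (θ : Stage12Params F N) (hP : θ.Provisos₁₂ F N), θ.Admissible F N → D = datumOfRecord₁₂ F N θ hP →
      (∀ P, w.up P = upOfRecord₅C F N (θ.toStage5₁₂ F N) P) → ∀ P : B12.RunParams, B9LeafX (θ.res.Y P))
    (slots₀₇ : ∀ (θ : Stage12Params F N) (hP : θ.Provisos₁₂ F N), θ.Admissible F N → D = datumOfRecord₁₂ F N θ hP →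
      (∀ P, w.up P = upOfRecord₅C F N (θ.toStage5₁₂ F N) P) → ∀ P : B12.RunParams, B11Leaf (θ.res.Z P))
    (slots₀₈ : ∀ (θ : Stage12Params F N) (hP : θ.Provisos₁₂ F N), θ.Admissible F N → D = datumOfRecord₁₂ F N θ hP →
      (∀ P, w.up P = upOfRecord₅C F N (θ.toStage5₁₂ F N) P) → ∀ P : B12.RunParams,
        ∃ (Xc : PrintedCarriersR) (I : Type) (C : B10Assembly.Consts) (T : I → B10.TowerRun),
          Nonempty (∀ i, B10Assembly.LeafSystem C (T i)) ∧ θ.res.X P = Xc.withTowerRuns10 T)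
    (slot12 : ∀ (θ : Stage12Params F N) (hP : θ.Provisos₁₂ F N), θ.Admissible F N → D = datumOfRecord₁₂ F N θ hP → w.γ ≤ θ.γ →
      (∀ P, w.up P = upOfRecord₅C F N (θ.toStage5₁₂ F N) P) → ∀ P : B12.RunParams, B12Sec2to5.Lemma4Printed (θ.res.X P).F12 (θ.res.X P).c12)
    (h11dom : ∀ (θ : Stage12Params F N) (hP : θ.Provisos₁₂ F N), θ.Admissible F N → D = datumOfRecord₁₂ F N θ hP → w.γ ≤ θ.γ →
      ∀ (p : B12.RunParams) (k : ℕ), k ≤ p.K →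
        ∀ V ∈ domAltOfRecord F N θ.ν p.K k, UkExists F N p.K k θ.εbg V ∧ UniqueUkOrbit F N p.K k θ.εbg V)
    (hres : ∀ (θ : Stage12Params F N) (hP : θ.Provisos₁₂ F N), θ.Admissible F N → D = datumOfRecord₁₂ F N θ hP → w.γ ≤ θ.γ →
      ∀ (p : B12.RunParams) (k : ℕ), k ≤ p.K → HRestrict F N θ.εbg p.K k (domAltOfRecord F N θ.ν p.K k))
    (huniq : ∀ (θ : Stage12Params F N) (hP : θ.Provisos₁₂ F N), θ.Admissible F N → D = datumOfRecord₁₂ F N θ hP → w.γ ≤ θ.γ →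
      ∀ (p : B12.RunParams) (k : ℕ), k ≤ p.K → ∀ V ∈ domAltOfRecord F N θ.ν p.K k, ∀ j < k,
        UniqueUkOrbit F N p.K (j + 1) θ.εbg (Averaging.iter (avOfRecord F N p.K) (j + 1) (Uk F N p.K k θ.εbg V)))
    (slots₁₀ : ∀ (θ : Stage12Params F N) (hP : θ.Provisos₁₂ F N), θ.Admissible F N → D = datumOfRecord₁₂ F N θ hP →
      (∀ P, w.up P = upOfRecord₅C F N (θ.toStage5₁₂ F N) P) → ∀ P : B12.RunParams,
        B9LeafX (θ.res.Y P) →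
          (B10.Thm1PrintedCompact (θ.res.X P).runs10 ∧ B10.Thm2Printed (θ.res.X P).runs10) →
            B11Leaf (θ.res.Z P) → B12Sec2to5.Lemma4Printed (θ.res.X P).F12 (θ.res.X P).c12 →
              B13.Lemma1Printed (θ.res.X P).S13 (θ.res.X P).c13 ∧ B13.Lemma2Printed (θ.res.X P).S13 (θ.res.X P).c13 ∧
                B13.Lemma3Printed (θ.res.X P).S13 (θ.res.X P).c13)
    (slot11 : ∀ (θ : Stage12Params F N) (hP : θ.Provisos₁₂ F N), θ.Admissible F N → D = datumOfRecord₁₂ F N θ hP →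
      (∀ P, w.up P = upOfRecord₅C F N (θ.toStage5₁₂ F N) P) → ∀ P : B12.RunParams,
        (leavesP w P).b7 → (leavesP w P).b8 → (leavesP w P).b9 → (leavesP w P).b10 → (leavesP w P).b11 →
          (leavesP w P).smallCouplings → (leavesP w P).smallFieldInductive → (leavesP w P).flowControl →
            ∀ k, k < P.K → SLaw₁₂ F N θ P k → TLaw₁₂ F N θ P k)
    (slots₁₂ : ∀ (θ : Stage12Params F N) (hP : θ.Provisos₁₂ F N), θ.Admissible F N → D = datumOfRecord₁₂ F N θ hP →
      (∀ P, w.up P = upOfRecord₅C F N (θ.toStage5₁₂ F N) P) → ∀ P : B12.RunParams, B15Leaf (θ.res.W P))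
    (hR : ∀ P : B12.RunParams, (w.up P).rOperation)
    (hcor3 : ∃ (em ep : ℝ → ℝ) (R : B14Cor3.ReprFamily D.C),
      B14Cor3.LeafH D.C R w.γ ∧ B14Cor3.LeafU1 D.C R w.γ ∧ B14Cor3.LeafU2 D.C R w.γ ep ∧ B14Cor3.LeafL1 D.C R w.γ ∧ B14Cor3.LeafL2 D.C R w.γ em)
    (hlo : BetaLowerH w.b γ₀ D.βfun) (hhi : BetaUpperH w.βup γ₀ D.βfun) :
    B16.EndStatementBPrinted D.C :=
  N24_at_record₁₂C_knit_N11_pinned h hγ₀ slots₀₅ slots₀₆ slots₀₇ slots₀₈ (N24_b12_main_of_isRecordOfRecord₁₂C_of_slots h slot12 h11dom hres huniq)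
    slots₁₀ slot11 slots₁₂ hR hcor3 hlo hhi

/-- **THE CONSEQUENT OF ITEM K1′ `StabilityBAtRecordR12e` IN ITS θ-KEYED SHAPE OF RECORD, REV 15, N09 AND N11 BY NAME** (module 26's `N24_stabilityBR12e_thetaShape15_knit_N11_pinned`
with `h09` ↦ §0; guard `hU : θ.ZtUnity F N ∧ θ.SlotsNondegenerate` DISPLAYED, K0′'s product).  COMPOSITE: the item's body GIVEN the children; nothing is discharged.
[cite: Balaban1989LargeFieldII, Thm 1 p.355 + p.391; Balaban1988Convergent, (3.16)–(3.22) pp.268–269; Balaban1987RG1, Thm 3 p.264, (0.17)–(0.20) pp.255–256; Balaban1985Variational, Thm 1 p.279 (bookkeeping + elementary window)] -/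
theorem N24_stabilityBR12e_thetaShape15_knit_N09_N11_pinned (h : IsRecordOfRecord₁₂C F N D w) {γ₀ : ℝ} (hγ₀ : w.γ ≤ γ₀)
    (θ : Stage12Params F N) (hP : θ.Provisos₁₂ F N) (hθ : θ.Admissible F N) (hU : θ.ZtUnity F N ∧ θ.SlotsNondegenerate)
    (hD : D = datumOfRecord₁₂ F N θ hP)
    (slots₀₅ : ∀ (θ : Stage12Params F N) (hP : θ.Provisos₁₂ F N), θ.Admissible F N → D = datumOfRecord₁₂ F N θ hP →
      (∀ P, w.up P = upOfRecord₅C F N (θ.toStage5₁₂ F N) P) → ∀ P : B12.RunParams,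
        B8LeafR (θ.res.X P).d8 (θ.res.X P).L8 (θ.res.X P).C₂ (θ.res.X P).B₁' (θ.res.X P).B₀' (θ.res.X P).B₁ (θ.res.X P).B₂ (θ.res.X P).c₁
          (θ.res.X P).inp8 (θ.res.X P).B₀β (θ.res.X P).loc8 (θ.res.X P).fam8R (θ.res.X P).lan8 (θ.res.X P).cub8 (θ.res.X P).toAxial8)
    (slots₀₆ : ∀ (θ : Stage12Params F N) (hP : θ.Provisos₁₂ F N), θ.Admissible F N → D = datumOfRecord₁₂ F N θ hP →
      (∀ P, w.up P = upOfRecord₅C F N (θ.toStage5₁₂ F N) P) → ∀ P : B12.RunParams, B9LeafX (θ.res.Y P))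
    (slots₀₇ : ∀ (θ : Stage12Params F N) (hP : θ.Provisos₁₂ F N), θ.Admissible F N → D = datumOfRecord₁₂ F N θ hP →
      (∀ P, w.up P = upOfRecord₅C F N (θ.toStage5₁₂ F N) P) → ∀ P : B12.RunParams, B11Leaf (θ.res.Z P))
    (slots₀₈ : ∀ (θ : Stage12Params F N) (hP : θ.Provisos₁₂ F N), θ.Admissible F N → D = datumOfRecord₁₂ F N θ hP →
      (∀ P, w.up P = upOfRecord₅C F N (θ.toStage5₁₂ F N) P) → ∀ P : B12.RunParams,
        ∃ (Xc : PrintedCarriersR) (I : Type) (C : B10Assembly.Consts) (T : I → B10.TowerRun),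
          Nonempty (∀ i, B10Assembly.LeafSystem C (T i)) ∧ θ.res.X P = Xc.withTowerRuns10 T)
    (slot12 : ∀ (θ : Stage12Params F N) (hP : θ.Provisos₁₂ F N), θ.Admissible F N → D = datumOfRecord₁₂ F N θ hP → w.γ ≤ θ.γ →
      (∀ P, w.up P = upOfRecord₅C F N (θ.toStage5₁₂ F N) P) → ∀ P : B12.RunParams, B12Sec2to5.Lemma4Printed (θ.res.X P).F12 (θ.res.X P).c12)
    (h11dom : ∀ (θ : Stage12Params F N) (hP : θ.Provisos₁₂ F N), θ.Admissible F N → D = datumOfRecord₁₂ F N θ hP → w.γ ≤ θ.γ →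
      ∀ (p : B12.RunParams) (k : ℕ), k ≤ p.K →
        ∀ V ∈ domAltOfRecord F N θ.ν p.K k, UkExists F N p.K k θ.εbg V ∧ UniqueUkOrbit F N p.K k θ.εbg V)
    (hres : ∀ (θ : Stage12Params F N) (hP : θ.Provisos₁₂ F N), θ.Admissible F N → D = datumOfRecord₁₂ F N θ hP → w.γ ≤ θ.γ →
      ∀ (p : B12.RunParams) (k : ℕ), k ≤ p.K → HRestrict F N θ.εbg p.K k (domAltOfRecord F N θ.ν p.K k))
    (huniq : ∀ (θ : Stage12Params F N) (hP : θ.Provisos₁₂ F N), θ.Admissible F N → D = datumOfRecord₁₂ F N θ hP → w.γ ≤ θ.γ →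
      ∀ (p : B12.RunParams) (k : ℕ), k ≤ p.K → ∀ V ∈ domAltOfRecord F N θ.ν p.K k, ∀ j < k,
        UniqueUkOrbit F N p.K (j + 1) θ.εbg (Averaging.iter (avOfRecord F N p.K) (j + 1) (Uk F N p.K k θ.εbg V)))
    (slots₁₀ : ∀ (θ : Stage12Params F N) (hP : θ.Provisos₁₂ F N), θ.Admissible F N → D = datumOfRecord₁₂ F N θ hP →
      (∀ P, w.up P = upOfRecord₅C F N (θ.toStage5₁₂ F N) P) → ∀ P : B12.RunParams,
        B9LeafX (θ.res.Y P) →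
          (B10.Thm1PrintedCompact (θ.res.X P).runs10 ∧ B10.Thm2Printed (θ.res.X P).runs10) →
            B11Leaf (θ.res.Z P) → B12Sec2to5.Lemma4Printed (θ.res.X P).F12 (θ.res.X P).c12 →
              B13.Lemma1Printed (θ.res.X P).S13 (θ.res.X P).c13 ∧ B13.Lemma2Printed (θ.res.X P).S13 (θ.res.X P).c13 ∧
                B13.Lemma3Printed (θ.res.X P).S13 (θ.res.X P).c13)
    (slot11 : ∀ (θ : Stage12Params F N) (hP : θ.Provisos₁₂ F N), θ.Admissible F N → D = datumOfRecord₁₂ F N θ hP →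
      (∀ P, w.up P = upOfRecord₅C F N (θ.toStage5₁₂ F N) P) → ∀ P : B12.RunParams,
        (leavesP w P).b7 → (leavesP w P).b8 → (leavesP w P).b9 → (leavesP w P).b10 → (leavesP w P).b11 →
          (leavesP w P).smallCouplings → (leavesP w P).smallFieldInductive → (leavesP w P).flowControl →
            ∀ k, k < P.K → SLaw₁₂ F N θ P k → TLaw₁₂ F N θ P k)
    (slots₁₂ : ∀ (θ : Stage12Params F N) (hP : θ.Provisos₁₂ F N), θ.Admissible F N → D = datumOfRecord₁₂ F N θ hP →
      (∀ P, w.up P = upOfRecord₅C F N (θ.toStage5₁₂ F N) P) → ∀ P : B12.RunParams, B15Leaf (θ.res.W P))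
    (hR : ∀ P : B12.RunParams, (w.up P).rOperation)
    (hcor3 : ∃ (em ep : ℝ → ℝ) (R : B14Cor3.ReprFamily D.C),
      B14Cor3.LeafH D.C R w.γ ∧ B14Cor3.LeafU1 D.C R w.γ ∧ B14Cor3.LeafU2 D.C R w.γ ep ∧ B14Cor3.LeafL1 D.C R w.γ ∧ B14Cor3.LeafL2 D.C R w.γ em)
    (hlo : BetaLowerH w.b γ₀ D.βfun) (hhi : BetaUpperH w.βup γ₀ D.βfun) :
    ∃ (θ' : Stage12Params F N) (h' : θ'.Provisos₁₂ F N), (θ'.ZtUnity F N ∧ θ'.SlotsNondegenerate) ∧ θ'.Admissible F N ∧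
      B16.EndStatementBPrinted (datumOfRecord₁₂ F N θ' h').C ∧
      ∃ γ₁ : ℝ, 0 < γ₁ ∧ ∀ γ : ℝ, 0 < γ → γ ≤ γ₁ → ∃ P : B12.RunParams, 1 ≤ P.K ∧ ((datumOfRecord₁₂ F N θ' h').C P).flow.InInterval γ P.K :=
  N24_stabilityBR12e_thetaShape15_knit_N11_pinned h hγ₀ θ hP hθ hU hD slots₀₅ slots₀₆ slots₀₇ slots₀₈
    (N24_b12_main_of_isRecordOfRecord₁₂C_of_slots h slot12 h11dom hres huniq) slots₁₀ slot11 slots₁₂ hR hcor3 hlo hhi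

/-! ## §2. The thirteen nodes at a world of the Stage-12 record, N09 and N11 by name (the `stub_nodes12` consequent with no pure binder) -/

/-- **N24 · THE THIRTEEN DAG NODES AT THE RE-READ WORLD OF A STAGE-12 RECORD, N09 AND N11 BY NAME** (module 26's `N24_nodes₁₂C_knit_N11_pinned` with `h09` ↦ §0): six θ-keyed
residual-carrier sockets, **N09** ← `slot12` + `h11dom` + `hres` + `huniq`, **N11** ← `slot11`, **N13** ← `hR` + `hcor3` ⇒ `∃ (e₋, e₊), IsRecordOfRecord₁₂C F N D {w with em, ep} ∧ ∀ P, Nodes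
(leavesP {w with em, ep} P)`.  THE HYPOTHESIS LIST IS «WHICH CHILD BLOCKS `stub_nodes12` AT A ₁₂C RECORD» WITH NO PURE NODE BINDER.
[cite: Balaban1989LargeFieldII, Thm 1 p.355, (0.1) pp.355–356, p.387, p.391; Balaban1988Convergent, Thm 1 p.262, Theorem p.245, p.244, Cor. 3 (2.50) p.264 and pp.283–284; Balaban1987RG1, Thm 1 p.259, Thm 3 p.264, Lemma 4 (3.53) p.280, (1.1)–(1.3) p.260; Balaban1985Variational, Thm 1 (8)–(10) p.279; Balaban1985RegularSpaces, Thms 2, 4, 8 pp.83–101; Balaban1985BackgroundPropagators, Thms 3.1–3.15 pp.397–432; Balaban1985UV3, Thm 1 p.257 + Thm 2 p.272; Balaban1988RG2Cluster, Lemmas 1–3 pp.9, 11, 20; Balaban1989LargeFieldI, Prop. 1 p.194 (bookkeeping over the Stage-12 record)] -/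
theorem N24_nodes₁₂C_knit_N09_N11_pinned (h : IsRecordOfRecord₁₂C F N D w)
    (slots₀₅ : ∀ (θ : Stage12Params F N) (hP : θ.Provisos₁₂ F N), θ.Admissible F N → D = datumOfRecord₁₂ F N θ hP →
      (∀ P, w.up P = upOfRecord₅C F N (θ.toStage5₁₂ F N) P) → ∀ P : B12.RunParams,
        B8LeafR (θ.res.X P).d8 (θ.res.X P).L8 (θ.res.X P).C₂ (θ.res.X P).B₁' (θ.res.X P).B₀' (θ.res.X P).B₁ (θ.res.X P).B₂ (θ.res.X P).c₁
          (θ.res.X P).inp8 (θ.res.X P).B₀β (θ.res.X P).loc8 (θ.res.X P).fam8R (θ.res.X P).lan8 (θ.res.X P).cub8 (θ.res.X P).toAxial8)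
    (slots₀₆ : ∀ (θ : Stage12Params F N) (hP : θ.Provisos₁₂ F N), θ.Admissible F N → D = datumOfRecord₁₂ F N θ hP →
      (∀ P, w.up P = upOfRecord₅C F N (θ.toStage5₁₂ F N) P) → ∀ P : B12.RunParams, B9LeafX (θ.res.Y P))
    (slots₀₇ : ∀ (θ : Stage12Params F N) (hP : θ.Provisos₁₂ F N), θ.Admissible F N → D = datumOfRecord₁₂ F N θ hP →
      (∀ P, w.up P = upOfRecord₅C F N (θ.toStage5₁₂ F N) P) → ∀ P : B12.RunParams, B11Leaf (θ.res.Z P))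
    (slots₀₈ : ∀ (θ : Stage12Params F N) (hP : θ.Provisos₁₂ F N), θ.Admissible F N → D = datumOfRecord₁₂ F N θ hP →
      (∀ P, w.up P = upOfRecord₅C F N (θ.toStage5₁₂ F N) P) → ∀ P : B12.RunParams,
        ∃ (Xc : PrintedCarriersR) (I : Type) (C : B10Assembly.Consts) (T : I → B10.TowerRun),
          Nonempty (∀ i, B10Assembly.LeafSystem C (T i)) ∧ θ.res.X P = Xc.withTowerRuns10 T)
    (slot12 : ∀ (θ : Stage12Params F N) (hP : θ.Provisos₁₂ F N), θ.Admissible F N → D = datumOfRecord₁₂ F N θ hP → w.γ ≤ θ.γ →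
      (∀ P, w.up P = upOfRecord₅C F N (θ.toStage5₁₂ F N) P) → ∀ P : B12.RunParams, B12Sec2to5.Lemma4Printed (θ.res.X P).F12 (θ.res.X P).c12)
    (h11dom : ∀ (θ : Stage12Params F N) (hP : θ.Provisos₁₂ F N), θ.Admissible F N → D = datumOfRecord₁₂ F N θ hP → w.γ ≤ θ.γ →
      ∀ (p : B12.RunParams) (k : ℕ), k ≤ p.K →
        ∀ V ∈ domAltOfRecord F N θ.ν p.K k, UkExists F N p.K k θ.εbg V ∧ UniqueUkOrbit F N p.K k θ.εbg V)
    (hres : ∀ (θ : Stage12Params F N) (hP : θ.Provisos₁₂ F N), θ.Admissible F N → D = datumOfRecord₁₂ F N θ hP → w.γ ≤ θ.γ →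
      ∀ (p : B12.RunParams) (k : ℕ), k ≤ p.K → HRestrict F N θ.εbg p.K k (domAltOfRecord F N θ.ν p.K k))
    (huniq : ∀ (θ : Stage12Params F N) (hP : θ.Provisos₁₂ F N), θ.Admissible F N → D = datumOfRecord₁₂ F N θ hP → w.γ ≤ θ.γ →
      ∀ (p : B12.RunParams) (k : ℕ), k ≤ p.K → ∀ V ∈ domAltOfRecord F N θ.ν p.K k, ∀ j < k,
        UniqueUkOrbit F N p.K (j + 1) θ.εbg (Averaging.iter (avOfRecord F N p.K) (j + 1) (Uk F N p.K k θ.εbg V)))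
    (slots₁₀ : ∀ (θ : Stage12Params F N) (hP : θ.Provisos₁₂ F N), θ.Admissible F N → D = datumOfRecord₁₂ F N θ hP →
      (∀ P, w.up P = upOfRecord₅C F N (θ.toStage5₁₂ F N) P) → ∀ P : B12.RunParams,
        B9LeafX (θ.res.Y P) →
          (B10.Thm1PrintedCompact (θ.res.X P).runs10 ∧ B10.Thm2Printed (θ.res.X P).runs10) →
            B11Leaf (θ.res.Z P) → B12Sec2to5.Lemma4Printed (θ.res.X P).F12 (θ.res.X P).c12 →
              B13.Lemma1Printed (θ.res.X P).S13 (θ.res.X P).c13 ∧ B13.Lemma2Printed (θ.res.X P).S13 (θ.res.X P).c13 ∧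
                B13.Lemma3Printed (θ.res.X P).S13 (θ.res.X P).c13)
    (slot11 : ∀ (θ : Stage12Params F N) (hP : θ.Provisos₁₂ F N), θ.Admissible F N → D = datumOfRecord₁₂ F N θ hP →
      (∀ P, w.up P = upOfRecord₅C F N (θ.toStage5₁₂ F N) P) → ∀ P : B12.RunParams,
        (leavesP w P).b7 → (leavesP w P).b8 → (leavesP w P).b9 → (leavesP w P).b10 → (leavesP w P).b11 →
          (leavesP w P).smallCouplings → (leavesP w P).smallFieldInductive → (leavesP w P).flowControl →
            ∀ k, k < P.K → SLaw₁₂ F N θ P k → TLaw₁₂ F N θ P k)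
    (slots₁₂ : ∀ (θ : Stage12Params F N) (hP : θ.Provisos₁₂ F N), θ.Admissible F N → D = datumOfRecord₁₂ F N θ hP →
      (∀ P, w.up P = upOfRecord₅C F N (θ.toStage5₁₂ F N) P) → ∀ P : B12.RunParams, B15Leaf (θ.res.W P))
    (hR : ∀ P : B12.RunParams, (w.up P).rOperation)
    (hcor3 : ∃ (em ep : ℝ → ℝ) (R : B14Cor3.ReprFamily D.C),
      B14Cor3.LeafH D.C R w.γ ∧ B14Cor3.LeafU1 D.C R w.γ ∧ B14Cor3.LeafU2 D.C R w.γ ep ∧ B14Cor3.LeafL1 D.C R w.γ ∧ B14Cor3.LeafL2 D.C R w.γ em) :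
    ∃ em ep : ℝ → ℝ, IsRecordOfRecord₁₂C F N D { w with em := em, ep := ep } ∧
      ∀ P : B12.RunParams, Nodes (leavesP { w with em := em, ep := ep } P) :=
  N24_nodes₁₂C_knit_N11_pinned h slots₀₅ slots₀₆ slots₀₇ slots₀₈ (N24_b12_main_of_isRecordOfRecord₁₂C_of_slots h slot12 h11dom hres huniq)
    slots₁₀ slot11 slots₁₂ hR hcor3

/-! ## §3. The closer's pointed form with N09 by name -/

/-- **N24 · THE THIRTEEN DAG NODES AT A WORLD BOUND TO THE PRESENTATION, FROM THE POINTED CHILDREN, N09 BY NAME** (module 27's `N24_nodes₁₂_pointed` with the displayed Theorem-3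
member `h09T` ↦ `B12NodeKnitRecord12.thm3Member_stage12_of_hRestrict` at θ's level domains, pointwise in the run): **N09** ← own leaf `h09 : Lemma4Printed (θ.res.X P).F12 (θ.res.X P).c12`
+ [Balaban1985Variational] Thm 1 ×3 at `domAltOfRecord F N θ.ν P.K k` (`h11dom`, `hres`, `huniq`), the record's `contT` inside; every other child as in module 27 §1.  THE HYPOTHESIS LIST IS
«WHICH CHILD BLOCKS `stub_nodes12`» IN THE CLOSER'S FORM WITH NO PURE NODE BINDER. [cite: Balaban1989LargeFieldII, Thm 1 p.355, (0.1) pp.355–356, p.391; Balaban1988Convergent, Thm 1 p.262, Theorem p.245, Cor. 3 (2.50) p.264; Balaban1987RG1, Thm 1 p.259, Thm 3 p.264, Lemma 4 (3.53) p.280, (1.1)–(1.3) p.260; Balaban1985Variational, Thm 1 (8)–(10) p.279; Balaban1985RegularSpaces, Thms 2, 4, 8 pp.83–101; Balaban1985BackgroundPropagators, Thms 3.1–3.15 pp.397–432; Balaban1985UV3, Thm 1 p.257 + Thm 2 p.272; Balaban1988RG2Cluster, Lemmas 1–3 pp.9, 11, 20; Balaban1989LargeFieldI, Prop. 1 p.194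 (node bookkeeping at the presentation's own objects)] -/
theorem N24_nodes₁₂_pointed_N09 (θ : Stage12Params F N) (hP : θ.Provisos₁₂ F N) (hθ : θ.Admissible F N) (w : WorldP)
    (hC : w.C = (datumOfRecord₁₂ F N θ hP).C) (hγ : 0 < w.γ ∧ w.γ ≤ θ.γ) (hL : w.L = (θ.L : ℝ))
    (hup : ∀ P, w.up P = upOfRecord₅C F N (θ.toStage5₁₂ F N) P)
    (h05 : ∀ P : B12.RunParams,
      B8LeafR (θ.res.X P).d8 (θ.res.X P).L8 (θ.res.X P).C₂ (θ.res.X P).B₁' (θ.res.X P).B₀' (θ.res.X P).B₁ (θ.res.X P).B₂ (θ.res.X P).c₁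
        (θ.res.X P).inp8 (θ.res.X P).B₀β (θ.res.X P).loc8 (θ.res.X P).fam8R (θ.res.X P).lan8 (θ.res.X P).cub8 (θ.res.X P).toAxial8)
    (h06 : ∀ P : B12.RunParams, B9LeafX (θ.res.Y P))
    (h07 : ∀ P : B12.RunParams, B11Leaf (θ.res.Z P))
    (h08 : ∀ P : B12.RunParams, ∃ (Xc : PrintedCarriersR) (I : Type) (C : B10Assembly.Consts) (T : I → B10.TowerRun),
      Nonempty (∀ i, B10Assembly.LeafSystem C (T i)) ∧ θ.res.X P = Xc.withTowerRuns10 T)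
    (h09 : ∀ P : B12.RunParams, B12Sec2to5.Lemma4Printed (θ.res.X P).F12 (θ.res.X P).c12)
    (h11dom : ∀ (P : B12.RunParams) (k : ℕ), k ≤ P.K →
      ∀ V ∈ domAltOfRecord F N θ.ν P.K k, UkExists F N P.K k θ.εbg V ∧ UniqueUkOrbit F N P.K k θ.εbg V)
    (hres : ∀ (P : B12.RunParams) (k : ℕ), k ≤ P.K → HRestrict F N θ.εbg P.K k (domAltOfRecord F N θ.ν P.K k))
    (huniq : ∀ (P : B12.RunParams) (k : ℕ), k ≤ P.K → ∀ V ∈ domAltOfRecord F N θ.ν P.K k, ∀ j < k,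
      UniqueUkOrbit F N P.K (j + 1) θ.εbg (Averaging.iter (avOfRecord F N P.K) (j + 1) (Uk F N P.K k θ.εbg V)))
    (h10 : ∀ P : B12.RunParams, B9LeafX (θ.res.Y P) →
      (B10.Thm1PrintedCompact (θ.res.X P).runs10 ∧ B10.Thm2Printed (θ.res.X P).runs10) →
        B11Leaf (θ.res.Z P) → B12Sec2to5.Lemma4Printed (θ.res.X P).F12 (θ.res.X P).c12 →
          B13.Lemma1Printed (θ.res.X P).S13 (θ.res.X P).c13 ∧ B13.Lemma2Printed (θ.res.X P).S13 (θ.res.X P).c13 ∧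
            B13.Lemma3Printed (θ.res.X P).S13 (θ.res.X P).c13)
    (h11 : ∀ P : B12.RunParams, (leavesP w P).b7 → (leavesP w P).b8 → (leavesP w P).b9 → (leavesP w P).b10 → (leavesP w P).b11 →
      (leavesP w P).smallCouplings → (leavesP w P).smallFieldInductive → (leavesP w P).flowControl →
        ∀ k, k < P.K → SLaw₁₂ F N θ P k → TLaw₁₂ F N θ P k)
    (h12 : ∀ P : B12.RunParams, B15Leaf (θ.res.W P))
    (hR : ∀ (P : B12.RunParams) (k : ℕ), k < P.K → TLaw₁₂ F N θ P k → SLaw₁₂ F N θ P (k + 1))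
    (hcor3 : ∃ R : B14Cor3.ReprFamily (datumOfRecord₁₂ F N θ hP).C,
      B14Cor3.LeafH (datumOfRecord₁₂ F N θ hP).C R w.γ ∧ B14Cor3.LeafU1 (datumOfRecord₁₂ F N θ hP).C R w.γ ∧
        B14Cor3.LeafU2 (datumOfRecord₁₂ F N θ hP).C R w.γ w.ep ∧ B14Cor3.LeafL1 (datumOfRecord₁₂ F N θ hP).C R w.γ ∧
          B14Cor3.LeafL2 (datumOfRecord₁₂ F N θ hP).C R w.γ w.em) :
    IsRecordOfRecord₁₂C F N (datumOfRecord₁₂ F N θ hP) w ∧ ∀ P : B12.RunParams, Nodes (leavesP w P) :=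
  N24_nodes₁₂_pointed θ hP hθ w hC hγ hL hup h05 h06 h07 h08 h09
    (fun P => B12NodeKnitRecord12.thm3Member_stage12_of_hRestrict θ hP hC P (h11dom P) (hres P) (huniq P)) h10 h11 h12 hR hcor3

/-- **THE BODY OF `BetaWindowAtSomeRecord12` FROM THE POINTED CHILDREN WITH N09 BY NAME AND THE β-BOX PAIR** (module 27's `N24_betaWindowAtSomeRecord₁₂_of_pointed_of_boxH` with `h09T` ↦
[B11] Thm 1 ×3; general `N`, guard displayed).  Upper bound [Balaban1987RG1] (1.22) p. 264; lower with `w.b > 0` UNPRINTED (T09.F, NODE O).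
[cite: Balaban1987RG1, §1 (1.22) p.264, Thm 2 p.259, Thm 3 p.264, (0.17)–(0.20) pp.255–256; Balaban1985Variational, Thm 1 p.279; Balaban1989LargeFieldII, Thm 1 p.355 (bookkeeping)] -/
theorem N24_betaWindowAtSomeRecord₁₂_of_pointed_N09_of_boxH (θ : Stage12Params F N) (hP : θ.Provisos₁₂ F N) (hθ : θ.Admissible F N)
    (hU : θ.ZtUnity F N ∧ θ.SlotsNondegenerate) (w : WorldP)
    (hC : w.C = (datumOfRecord₁₂ F N θ hP).C) (hγ : 0 < w.γ ∧ w.γ ≤ θ.γ) (hL : w.L = (θ.L : ℝ))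
    (hup : ∀ P, w.up P = upOfRecord₅C F N (θ.toStage5₁₂ F N) P)
    (h05 : ∀ P : B12.RunParams,
      B8LeafR (θ.res.X P).d8 (θ.res.X P).L8 (θ.res.X P).C₂ (θ.res.X P).B₁' (θ.res.X P).B₀' (θ.res.X P).B₁ (θ.res.X P).B₂ (θ.res.X P).c₁
        (θ.res.X P).inp8 (θ.res.X P).B₀β (θ.res.X P).loc8 (θ.res.X P).fam8R (θ.res.X P).lan8 (θ.res.X P).cub8 (θ.res.X P).toAxial8)
    (h06 : ∀ P : B12.RunParams, B9LeafX (θ.res.Y P))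
    (h07 : ∀ P : B12.RunParams, B11Leaf (θ.res.Z P))
    (h08 : ∀ P : B12.RunParams, ∃ (Xc : PrintedCarriersR) (I : Type) (C : B10Assembly.Consts) (T : I → B10.TowerRun),
      Nonempty (∀ i, B10Assembly.LeafSystem C (T i)) ∧ θ.res.X P = Xc.withTowerRuns10 T)
    (h09 : ∀ P : B12.RunParams, B12Sec2to5.Lemma4Printed (θ.res.X P).F12 (θ.res.X P).c12)
    (h11dom : ∀ (P : B12.RunParams) (k : ℕ), k ≤ P.K →
      ∀ V ∈ domAltOfRecord F N θ.ν P.K k, UkExists F N P.K k θ.εbg V ∧ UniqueUkOrbit F N P.K k θ.εbg V)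
    (hres : ∀ (P : B12.RunParams) (k : ℕ), k ≤ P.K → HRestrict F N θ.εbg P.K k (domAltOfRecord F N θ.ν P.K k))
    (huniq : ∀ (P : B12.RunParams) (k : ℕ), k ≤ P.K → ∀ V ∈ domAltOfRecord F N θ.ν P.K k, ∀ j < k,
      UniqueUkOrbit F N P.K (j + 1) θ.εbg (Averaging.iter (avOfRecord F N P.K) (j + 1) (Uk F N P.K k θ.εbg V)))
    (h10 : ∀ P : B12.RunParams, B9LeafX (θ.res.Y P) →
      (B10.Thm1PrintedCompact (θ.res.X P).runs10 ∧ B10.Thm2Printed (θ.res.X P).runs10) →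
        B11Leaf (θ.res.Z P) → B12Sec2to5.Lemma4Printed (θ.res.X P).F12 (θ.res.X P).c12 →
          B13.Lemma1Printed (θ.res.X P).S13 (θ.res.X P).c13 ∧ B13.Lemma2Printed (θ.res.X P).S13 (θ.res.X P).c13 ∧
            B13.Lemma3Printed (θ.res.X P).S13 (θ.res.X P).c13)
    (h11 : ∀ P : B12.RunParams, (leavesP w P).b7 → (leavesP w P).b8 → (leavesP w P).b9 → (leavesP w P).b10 → (leavesP w P).b11 →
      (leavesP w P).smallCouplings → (leavesP w P).smallFieldInductive → (leavesP w P).flowControl →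
        ∀ k, k < P.K → SLaw₁₂ F N θ P k → TLaw₁₂ F N θ P k)
    (h12 : ∀ P : B12.RunParams, B15Leaf (θ.res.W P))
    (hR : ∀ (P : B12.RunParams) (k : ℕ), k < P.K → TLaw₁₂ F N θ P k → SLaw₁₂ F N θ P (k + 1))
    (hcor3 : ∃ R : B14Cor3.ReprFamily (datumOfRecord₁₂ F N θ hP).C,
      B14Cor3.LeafH (datumOfRecord₁₂ F N θ hP).C R w.γ ∧ B14Cor3.LeafU1 (datumOfRecord₁₂ F N θ hP).C R w.γ ∧
        B14Cor3.LeafU2 (datumOfRecord₁₂ F N θ hP).C R w.γ w.ep ∧ B14Cor3.LeafL1 (datumOfRecord₁₂ F N θ hP).C R w.γ ∧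
          B14Cor3.LeafL2 (datumOfRecord₁₂ F N θ hP).C R w.γ w.em)
    (hlo : BetaLowerH w.b w.γ (datumOfRecord₁₂ F N θ hP).βfun) (hhi : BetaUpperH w.βup w.γ (datumOfRecord₁₂ F N θ hP).βfun) :
    ∃ (θ' : Stage12Params F N) (h' : θ'.Provisos₁₂ F N) (w' : WorldP), (θ'.ZtUnity F N ∧ θ'.SlotsNondegenerate) ∧ θ'.Admissible F N ∧
      IsRecordOfRecord₁₂C F N (datumOfRecord₁₂ F N θ' h') w' ∧ (∀ P : B12.RunParams, Nodes (leavesP w' P)) ∧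
      BetaBoundsInInterval w'.C.toB12 w'.γ w'.b w'.βup ∧
      ∃ γ₁ : ℝ, 0 < γ₁ ∧ ∀ γ : ℝ, 0 < γ → γ ≤ γ₁ → ∃ P : B12.RunParams, 1 ≤ P.K ∧ ((datumOfRecord₁₂ F N θ' h').C P).flow.InInterval γ P.K :=
  N24_betaWindowAtSomeRecord₁₂_of_pointed_of_boxH θ hP hθ hU w hC hγ hL hup h05 h06 h07 h08 h09
    (fun P => B12NodeKnitRecord12.thm3Member_stage12_of_hRestrict θ hP hC P (h11dom P) (hres P) (huniq P)) h10 h11 h12 hR hcor3 hlo hhi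

/-- **THE CONSEQUENT OF ITEM K1′ `StabilityBAtRecordR12e` (rev 15, stmt-QuantumFields-19903) FROM THE POINTED CHILDREN WITH N09 BY NAME AND THE β-BOX PAIR**, witnessed by `(θ, hP)`
(module 27's `N24_stabilityBR12e_thetaShape15_pointed` with `h09T` ↦ [B11] Thm 1 ×3).  THE CLOSER'S RECIPE: a guarded admissible presentation (K0′ `Record12Inhabited`), the children at
its own objects — N05 [B8] residual leaf · N06 def-Y's leaf · N07 [B11] leaf · N08 leaf-system form · N09 Lemma-4 leaf + [B11] Thm 1 ×3 at the level domains · N10 B13 socket · N11 (S1ᵀ) ·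
N12 [IV] leaf · N13 𝐑-leaf + Cor.-3 ×5 — and the β-box pair (β⁺ [I] p. 264; `b > 0` NODE O, UNPRINTED).  COMPOSITE: nothing is discharged.
[cite: Balaban1989LargeFieldII, Thm 1 p.355 + p.391; Balaban1988Convergent, (3.16)–(3.22) pp.268–269; Balaban1987RG1, Thm 3 p.264, (0.17)–(0.20) pp.255–256 and (1.22) p.264; Balaban1985Variational, Thm 1 p.279 (bookkeeping + elementary window)] -/
theorem N24_stabilityBR12e_thetaShape15_pointed_N09 (θ : Stage12Params F N) (hP : θ.Provisos₁₂ F N) (hθ : θ.Admissible F N)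
    (hU : θ.ZtUnity F N ∧ θ.SlotsNondegenerate) (w : WorldP)
    (hC : w.C = (datumOfRecord₁₂ F N θ hP).C) (hγ : 0 < w.γ ∧ w.γ ≤ θ.γ) (hL : w.L = (θ.L : ℝ))
    (hup : ∀ P, w.up P = upOfRecord₅C F N (θ.toStage5₁₂ F N) P)
    (h05 : ∀ P : B12.RunParams,
      B8LeafR (θ.res.X P).d8 (θ.res.X P).L8 (θ.res.X P).C₂ (θ.res.X P).B₁' (θ.res.X P).B₀' (θ.res.X P).B₁ (θ.res.X P).B₂ (θ.res.X P).c₁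
        (θ.res.X P).inp8 (θ.res.X P).B₀β (θ.res.X P).loc8 (θ.res.X P).fam8R (θ.res.X P).lan8 (θ.res.X P).cub8 (θ.res.X P).toAxial8)
    (h06 : ∀ P : B12.RunParams, B9LeafX (θ.res.Y P))
    (h07 : ∀ P : B12.RunParams, B11Leaf (θ.res.Z P))
    (h08 : ∀ P : B12.RunParams, ∃ (Xc : PrintedCarriersR) (I : Type) (C : B10Assembly.Consts) (T : I → B10.TowerRun),
      Nonempty (∀ i, B10Assembly.LeafSystem C (T i)) ∧ θ.res.X P = Xc.withTowerRuns10 T)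
    (h09 : ∀ P : B12.RunParams, B12Sec2to5.Lemma4Printed (θ.res.X P).F12 (θ.res.X P).c12)
    (h11dom : ∀ (P : B12.RunParams) (k : ℕ), k ≤ P.K →
      ∀ V ∈ domAltOfRecord F N θ.ν P.K k, UkExists F N P.K k θ.εbg V ∧ UniqueUkOrbit F N P.K k θ.εbg V)
    (hres : ∀ (P : B12.RunParams) (k : ℕ), k ≤ P.K → HRestrict F N θ.εbg P.K k (domAltOfRecord F N θ.ν P.K k))
    (huniq : ∀ (P : B12.RunParams) (k : ℕ), k ≤ P.K → ∀ V ∈ domAltOfRecord F N θ.ν P.K k, ∀ j < k,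
      UniqueUkOrbit F N P.K (j + 1) θ.εbg (Averaging.iter (avOfRecord F N P.K) (j + 1) (Uk F N P.K k θ.εbg V)))
    (h10 : ∀ P : B12.RunParams, B9LeafX (θ.res.Y P) →
      (B10.Thm1PrintedCompact (θ.res.X P).runs10 ∧ B10.Thm2Printed (θ.res.X P).runs10) →
        B11Leaf (θ.res.Z P) → B12Sec2to5.Lemma4Printed (θ.res.X P).F12 (θ.res.X P).c12 →
          B13.Lemma1Printed (θ.res.X P).S13 (θ.res.X P).c13 ∧ B13.Lemma2Printed (θ.res.X P).S13 (θ.res.X P).c13 ∧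
            B13.Lemma3Printed (θ.res.X P).S13 (θ.res.X P).c13)
    (h11 : ∀ P : B12.RunParams, (leavesP w P).b7 → (leavesP w P).b8 → (leavesP w P).b9 → (leavesP w P).b10 → (leavesP w P).b11 →
      (leavesP w P).smallCouplings → (leavesP w P).smallFieldInductive → (leavesP w P).flowControl →
        ∀ k, k < P.K → SLaw₁₂ F N θ P k → TLaw₁₂ F N θ P k)
    (h12 : ∀ P : B12.RunParams, B15Leaf (θ.res.W P))
    (hR : ∀ (P : B12.RunParams) (k : ℕ), k < P.K → TLaw₁₂ F N θ P k → SLaw₁₂ F N θ P (k + 1))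
    (hcor3 : ∃ R : B14Cor3.ReprFamily (datumOfRecord₁₂ F N θ hP).C,
      B14Cor3.LeafH (datumOfRecord₁₂ F N θ hP).C R w.γ ∧ B14Cor3.LeafU1 (datumOfRecord₁₂ F N θ hP).C R w.γ ∧
        B14Cor3.LeafU2 (datumOfRecord₁₂ F N θ hP).C R w.γ w.ep ∧ B14Cor3.LeafL1 (datumOfRecord₁₂ F N θ hP).C R w.γ ∧
          B14Cor3.LeafL2 (datumOfRecord₁₂ F N θ hP).C R w.γ w.em)
    (hlo : BetaLowerH w.b w.γ (datumOfRecord₁₂ F N θ hP).βfun) (hhi : BetaUpperH w.βup w.γ (datumOfRecord₁₂ F N θ hP).βfun) :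
    ∃ (θ' : Stage12Params F N) (h' : θ'.Provisos₁₂ F N), (θ'.ZtUnity F N ∧ θ'.SlotsNondegenerate) ∧ θ'.Admissible F N ∧
      B16.EndStatementBPrinted (datumOfRecord₁₂ F N θ' h').C ∧
      ∃ γ₁ : ℝ, 0 < γ₁ ∧ ∀ γ : ℝ, 0 < γ → γ ≤ γ₁ → ∃ P : B12.RunParams, 1 ≤ P.K ∧ ((datumOfRecord₁₂ F N θ' h').C P).flow.InInterval γ P.K :=
  N24_stabilityBR12e_thetaShape15_pointed θ hP hθ hU w hC hγ hL hup h05 h06 h07 h08 h09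
    (fun P => B12NodeKnitRecord12.thm3Member_stage12_of_hRestrict θ hP hC P (h11dom P) (hres P) (huniq P)) h10 h11 h12 hR hcor3 hlo hhi

end Literature.MathematicalPhysics.QuantumFieldTheory.Balaban1983to89.Node00

end
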